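import Mathlib
import HarnessLib
import Summits.PneNP.PneNP.Theses.OverlapGapAlgebra
import Literature.Computability.Complexity.ConstantDepth

/-!
# Sketch — crux-ideate `stmt-PneNP-2460` (`SearchHardWindow`), ideator 1, round 1

First-lemma signatures for two idea cards (statements only; nothing here is proved):

* Card A `approx-degree-ladder`: `IsJuntaSum` (Efron–Stein degree ≤ D on the literal product
  space), `SignSolves`, `StrongLowDegreeHardness` (HS25 Cor. 3.21, deterministic-sign corollary, at
  the route's window density), `PolyTimeLowDegreeSimulable` (the kernel), `ACZeroRung` (the first
  unconditional rung: AC⁰ solvers fail, via the tree's Tal Fourier-tail theorem), `LineA`.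
* Card B `quiet-planting-one-wayness`: `Z`, `plantedPairs`, `PlantedExpOneWay` (kernel),
  `gapRate`, `LowerTailZ` (transfer stub), `LineB`.
-/

namespace Summit.PneNP.PneNP.Cruxes.SearchHardWindow.Sketch

open Finset Filter Asymptotics
open Literature.Computability.Complexity
open Summit.PneNP.PneNP.Theses.OverlapGapAlgebra

noncomputable section
open scoped Classical

/-- Instances of the with-replacement literal model: `m` clauses of `k` literals over `n` variables. -/
abbrev Inst (m k n : ℕ) := Fin m → Fin k → Fin n × Bool

/-- `σ` satisfies `Φ` (literal `(v,b)` true under `σ` iff `σ v = b`). -/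
def Satisfies {m k n : ℕ} (σ : Fin n → Bool) (Φ : Inst m k n) : Prop :=
  ∀ i, ∃ j, σ (Φ i j).1 = (Φ i j).2

/-- The assignment a word-function `f` proposes on `Φ` (input/output conventions of the crux). -/
def solverOutput (f : List Bool → List Bool) {m k n : ℕ} (Φ : Inst m k n) : Fin n → Bool :=
  fun v => (f (encodingCNF.encode
    (List.ofFn fun a => List.ofFn fun b => (((Φ a b).1 : ℕ), (Φ a b).2)))).getD v false

/-- The route's window density `α_k = 5 · 2^k ln k / k` (κ = 5 > κ* ≈ 4.911). -/
def windowDensity (k : ℕ) : ℝ := 5 * 2 ^ k * Real.log k / k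

/-! ## Card A — approximate-degree ladder -/

/-- `F` is a sum of `D`-juntas in the `m·k` literal coordinates (= Efron–Stein/Fourier degree `≤ D`
on the product space `(Fin n × Bool)^{m k}`, the degree notion of BH21 Def. 2.2 / HS25 §3.3). -/
def IsJuntaSum {m k n : ℕ} (D : ℕ) (F : Inst m k n → (Fin n → ℝ)) : Prop :=
  ∃ (S : Finset (Finset (Fin m × Fin k))) (G : Finset (Fin m × Fin k) → Inst m k n → (Fin n → ℝ)),
    (∀ T ∈ S, T.card ≤ D ∧ ∀ Φ Ψ : Inst m k n, (∀ p ∈ T, Φ p.1 p.2 = Ψ p.1 p.2) → G T Φ = G T Ψ) ∧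
    ∀ Φ, F Φ = ∑ T ∈ S, G T Φ

/-- Deterministic-sign success: every coordinate outside `(-1,1)` (so HS25's randomised rounding
`round_U`, `U ~ Unif[-1,1]`, is the sign) and the sign assignment satisfies `Φ`. -/
def SignSolves {m k n : ℕ} (y : Fin n → ℝ) (Φ : Inst m k n) : Prop :=
  (∀ v, 1 ≤ |y v|) ∧ Satisfies (fun v => decide (0 ≤ y v)) Φ

/-- **Strong low-degree hardness of random k-SAT in the window** (Huang–Sellke 2025, arXiv:2501.06427,
Cor. 3.21, specialised to outputs outside the rounding band): for `k ≥ k₀`, every family of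
degree-`o(n)` junta-sums with energy `∑_Φ ‖F Φ‖² ≤ C n · #Φ` sign-solves `F_k(n, ⌊α_k n⌋)` with
probability `→ 0`. Named-fact shaped (in print). -/
def StrongLowDegreeHardness : Prop :=
  ∃ k₀ : ℕ, ∀ k ≥ k₀, ∀ C : ℝ, 0 < C → ∀ D : ℕ → ℕ,
    (fun n => (D n : ℝ)) =o[atTop] (fun n => (n : ℝ)) →
    ∀ F : (n : ℕ) → (m : ℕ) → Inst m k n → (Fin n → ℝ),
      (∀ n m : ℕ, IsJuntaSum (D n) (F n m)) →
      (∀ n m : ℕ, m = ⌊windowDensity k * n⌋₊ →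
        ∑ Φ : Inst m k n, ∑ v, (F n m Φ v) ^ 2 ≤ C * n * Fintype.card (Inst m k n)) →
      ∀ ε : ℝ, 0 < ε → ∀ᶠ n : ℕ in atTop, ∀ m : ℕ, m = ⌊windowDensity k * n⌋₊ →
        ((univ.filter fun Φ : Inst m k n => SignSolves (F n m Φ) Φ).card : ℝ)
          ≤ ε * Fintype.card (Inst m k n)

/-- **KERNEL of card A** (conjecture-grade, the non-relativizing ingredient): a polynomial-time solver
with non-vanishing success on `F_k(n, ⌊α_k n⌋)` is success-matched, on the same `n`'s, by a
degree-`o(n)` junta-sum of linear energy (the algorithmic low-degree conjecture, k-SAT search instance). -/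
def PolyTimeLowDegreeSimulable : Prop :=
  ∀ k : ℕ, 3 ≤ k → ∀ f : List Bool → List Bool, IsPolyTime f → ∀ ε : ℝ, 0 < ε →
    (∃ᶠ n : ℕ in atTop, ∀ m : ℕ, m = ⌊windowDensity k * n⌋₊ →
      ε * Fintype.card (Inst m k n) ≤
        ((univ.filter fun Φ : Inst m k n => Satisfies (solverOutput f Φ) Φ).card : ℝ)) →
    ∃ (C : ℝ) (_ : 0 < C) (D : ℕ → ℕ) (_ : (fun n => (D n : ℝ)) =o[atTop] (fun n => (n : ℝ)))
      (F : (n : ℕ) → (m : ℕ) → Inst m k n → (Fin n → ℝ)),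
      (∀ n m : ℕ, IsJuntaSum (D n) (F n m)) ∧
      (∀ n m : ℕ, m = ⌊windowDensity k * n⌋₊ →
        ∑ Φ : Inst m k n, ∑ v, (F n m Φ v) ^ 2 ≤ C * n * Fintype.card (Inst m k n)) ∧
      ∃ᶠ n : ℕ in atTop, ∀ m : ℕ, m = ⌊windowDensity k * n⌋₊ →
        ε / 2 * Fintype.card (Inst m k n) ≤
          ((univ.filter fun Φ : Inst m k n => SignSolves (F n m Φ) Φ).card : ℝ)

/-- The composition the crux-plan skeleton must prove (elementary: pick `k ≥ max k₀ k₀' 3`,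
`α := windowDensity k`; a frequently-successful `f` yields a frequently-successful low-degree `F`,
contradicting `StrongLowDegreeHardness` eventually). -/
def LineA : Prop :=
  StrongLowDegreeHardness → PolyTimeLowDegreeSimulable → PositiveSatProbability → SearchHardWindow

/-! ### The first unconditional rung: AC⁰ solvers fail (uniform-bit literal encoding, `n = 2^j`) -/

/-- Input positions of the bit encoding: clause `a`, slot `b`, bit `some t` of the variable index
(`t < j`) or the sign bit `none`. The uniform measure on `BitIdx m k j → Bool` is exactly
`F_k(2^j, m)`. -/
abbrev BitIdx (m k j : ℕ) := Fin m × Fin k × Option (Fin j)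

/-- Decode a bit vector into an instance over `n = 2^j` variables. -/
def decodeInst {m k j : ℕ} (x : BitIdx m k j → Bool) : Inst m k (2 ^ j) :=
  fun a b => (finFunctionFinEquiv (fun t : Fin j => (if x (a, b, some t) then 1 else 0 : Fin 2)),
    x (a, b, none))

/-- **AC⁰ rung** (claimed NEW theorem; `StrongLowDegreeHardness` + the tree's Tal Fourier-tail bound
`tailWeight_le_tailBound`/`Circuit.exists_acForm` + Markov): for `k ≥ k₀`, every depth-`d`,
size-`n^c` family of `acBasis` circuits (one per output variable) solves `F_k(2^j, ⌊α_k 2^j⌋)` with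
probability `→ 0` as `j → ∞`. -/
def ACZeroRung : Prop :=
  ∃ k₀ : ℕ, ∀ k ≥ k₀, ∀ d c : ℕ, ∀ ε : ℝ, 0 < ε → ∀ᶠ j : ℕ in atTop, ∀ m : ℕ,
    m = ⌊windowDensity k * (2 ^ j : ℕ)⌋₊ →
    ∀ C : Fin (2 ^ j) → Circuit (BitIdx m k j),
      (∀ v, (C v).IsOver acBasis ∧ (C v).acDepth ≤ d ∧ (C v).size ≤ (2 ^ j) ^ c) →
      ((univ.filter fun x : BitIdx m k j → Bool =>
          Satisfies (fun v => (C v).eval x) (decodeInst x)).card : ℝ)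
        ≤ ε * Fintype.card (BitIdx m k j → Bool)

/-- The rung's dependence (what the lead proves first; no kernel involved). -/
def ACZeroRungFromStrongLDH : Prop := StrongLowDegreeHardness → ACZeroRung

/-! ## Card B — quiet planting: the hardness conjunct as exponential one-wayness -/

/-- Number of satisfying assignments. -/
def Z {m k n : ℕ} (Φ : Inst m k n) : ℕ := (univ.filter fun σ : Fin n → Bool => Satisfies σ Φ).card

/-- The planted model as a counting measure: uniform over pairs `(σ, Φ)` with `σ ⊨ Φ`
(`#plantedPairs = 2^n ((2n)^k - n^k)^m`; marginal on `Φ` ∝ `Z Φ`). -/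
def plantedPairs (m k n : ℕ) : Finset ((Fin n → Bool) × Inst m k n) :=
  univ.filter fun p => Satisfies p.1 p.2

/-- **KERNEL of card B**: the planted k-SAT sampler `(σ, coins) ↦ Φ` is exponentially one-way at
rate `c` against deterministic polynomial time (success = ANY satisfying assignment). -/
def PlantedExpOneWay (k : ℕ) (α c : ℝ) : Prop :=
  ∀ f : List Bool → List Bool, IsPolyTime f → ∀ᶠ n : ℕ in atTop, ∀ m : ℕ, m = ⌊α * n⌋₊ →
    (((plantedPairs m k n).filter fun p => Satisfies (solverOutput f p.2) p.2).card : ℝ)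
      ≤ Real.exp (-(c * n)) * (plantedPairs m k n).card

/-- Explicit slack of the unweighted planting: an upper bound on the annealed-minus-typical entropy
gap at `α_k` extracted from the Achlioptas–Peres weights (`≈ 1.8 √(ln k) 2^{-k/2}`; any `c₀(k) → 0`
would do for the kernel's plausibility). -/
def gapRate (k : ℕ) : ℝ := 4 * Real.sqrt (Real.log k) * (2 : ℝ) ^ (-(k : ℝ) / 2)

/-- **Transfer stub** (in print modulo assembly: AP04 weighted second moment + the Friedgut-type sharp
threshold for `{Z < 2^{nφ}}` of MRT09 / Abbe–Montanari 2013 Thm. 2 + a Chernoff bound on literal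
imbalances): satisfiable-but-solution-poor formulas are rare — w.h.p. `Z = 0` or
`Z ≥ e^{-c₀(k) n} · E[Z]`, `E[Z] = 2^n (1 - 2^{-k})^m`. -/
def LowerTailZ : Prop :=
  ∃ k₀ : ℕ, ∀ k ≥ k₀, ∀ δ : ℝ, 0 < δ → ∀ᶠ n : ℕ in atTop, ∀ m : ℕ, m = ⌊windowDensity k * n⌋₊ →
    ((univ.filter fun Φ : Inst m k n =>
        0 < Z Φ ∧ (Z Φ : ℝ) < Real.exp (-(gapRate k * n)) * (2 ^ n * (1 - ((2 : ℝ) ^ k)⁻¹) ^ m)).card : ℝ)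
      ≤ δ * Fintype.card (Inst m k n)

/-- Planted exponential one-wayness somewhere in the window, beating the slack. -/
def PlantedHardWindow : Prop :=
  ∃ k₀ : ℕ, ∀ k ≥ k₀, ∃ c : ℝ, gapRate k < c ∧ PlantedExpOneWay k (windowDensity k) c

/-- **First lemma of line B** (provable now, double counting): planted probability of an instance
event is its `Z`-weighted uniform count. -/
def PlantingIdentity : Prop :=
  ∀ (m k n : ℕ) (P : Inst m k n → Prop),
    ((plantedPairs m k n).filter fun p => P p.2).card = ∑ Φ ∈ univ.filter P, Z Φ

/-- The composition for the crux-plan skeleton (elementary given the three: on the success event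
`S` of `f`, `Pr_pl[S] ≥ e^{-c₀ n}(Pr[S] - δ - o(1))`, against `≤ e^{-c n}`, `c > c₀`). -/
def LineB : Prop :=
  PlantingIdentity → LowerTailZ → PlantedHardWindow → PositiveSatProbability → SearchHardWindow

end

end Summit.PneNP.PneNP.Cruxes.SearchHardWindow.Sketch
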